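import Literature.Computability.Complexity.Williams2014MachineA
import Literature.Computability.Complexity.CodeFPBudgets
import Literature.Computability.Complexity.BinarySubtraction
import HarnessLib

/-!
# Williams' generator `A` (Lemma 3.1), part 5: the stage function of `A` is polynomial time

R. Williams, *Nonuniform ACC circuit lower bounds*, J. ACM 61 (2014), proof of Lemma 3.1
(pp. 10–12): everything the generator `A` does besides its single `ACC`-SAT call is polynomial
time ("in polynomial time, `A` … constructs the circuit VALUE"). This file derives, in the
tree's typed calculus of polynomial-time maps on codes (`CodeFP.lean`, `CodeFPArith.lean`,
`CodeFPLists.lean`, `CodeFPBudgets.lean`), an `FP` function computing the packed stage function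
`packA ∘ stageA` of `Williams2014ValueCode.lean` / `Williams2014MachineA.lean` on every pair
`⟨x, z⟩` (`exists_stageAFn`), and concludes the discharge
`Williams2014_lemma_3_1_holds : Williams2014_lemma_3_1` by `Williams2014_lemma_3_1_of_stageA`;
with the other leaves of Thm. 3.2 already in the tree this also closes
`Williams2014_thm_3_2_holds`.

The derivation follows the mathematical definition of `stageA`: the numerology of the input
(`ctxOf`: width `w = n + c log n + c` by `natLog2Min`, the time bound by a fixed polynomial
`natPoly_code`/`unPoly_code`, one unary budget for all `List.range`s), the instance words
`x'_{p,pol}` (fixed-length numerals `natPad` by `falses_code`), the bits of a string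
(`explode_code`, by `strChunks`), the Cook–Levin clause generator in TEMPLATE form (`allTerms'`,
proved equal to `allTerms`: the machine-dependent tables `topTmpl`, `intTmpl`, `cellTmpl` are
constants of the program), the parser and validator of the guess (`decL_code`, `decStr_code`,
`deserialize'_code`, `validC_code` of `Williams2014SatInstanceFP.lean`), VALUE on codes
(`dnfCodeList`, block layer by `sGC'_code`) and the printout (`serialize_code`).

No new named fact is introduced; the file discharges `Williams2014_lemma_3_1`.

## References

* R. Williams, *Nonuniform ACC circuit lower bounds*, J. ACM 61 (2014) 2:1–2:32, Lemma 3.1 and its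
  proof (pp. 10–12), Thm. 3.2 [Williams2014].
* S. Arora, B. Barak, *Computational Complexity: A Modern Approach*, CUP 2009, §1.3 (polynomial-time
  closure: composition, bounded loops) [AroraBarakCC2009].
-/

noncomputable section

namespace Literature.Computability.Complexity

open Turing _root_.Computability Polynomial CodeFP Brick

namespace MachineA

open SatCode Tableau GateList WitnessCheck

attribute [local instance] Turing.FinTM2.kFin Turing.FinTM2.ΛFin Turing.FinTM2.σFin
  Turing.FinTM2.Γk₀Fin

/-! ### Calculus helpers: polynomials, unary arithmetic, padded numerals, bits of a string -/

/-- A fixed polynomial is computed on binary numerals. [cite: AroraBarakCC2009, §1.3] -/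
theorem natPoly_code (p : Polynomial ℕ) : CodeFP natE natE (fun n => p.eval n) := by
  induction p using Polynomial.induction_on' with
  | add p q hp hq => exact (natAdd.comp (hp.pair hq)).congr fun n => by simp
  | monomial k a =>
    exact (natMul.comp ((cst natE natE a).pair (natPow.comp ((CodeFP.id natE).pair (cst natE unE k))))).congr
      fun n => by simp [eval_monomial]

/-- Unary multiplication. [cite: AroraBarakCC2009, §1.3] -/
theorem unMul : CodeFP (pairE unE unE) unE (fun p => p.1 * p.2) :=
  ((ulength unitE).comp (unitsMul.comp ((replicateUnit.comp (fst _ _)).pair (replicateUnit.comp (snd _ _))))).congr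
    fun p => by simp

/-- Unary truncated subtraction. [folklore] -/
theorem unSub : CodeFP (pairE unE unE) unE (fun p => p.1 - p.2) :=
  (unOfNatMin.comp ((fst _ _).pair (natSub.comp ((natOfUn.comp (fst _ _)).pair (natOfUn.comp (snd _ _)))))).congr
    fun p => by simp only [id]; exact min_eq_left (Nat.sub_le _ _)

/-- A fixed polynomial is computed on unary numerals. [cite: AroraBarakCC2009, §1.3] -/
theorem unPoly_code (p : Polynomial ℕ) : CodeFP unE unE (fun n => p.eval n) := by
  induction p using Polynomial.induction_on' with
  | add p q hp hq => exact (unAdd.comp (hp.pair hq)).congr fun n => by simp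
  | monomial k a =>
    exact (unMul.comp ((cst unE unE a).pair ((ulength unitE).comp (unitsPow k)))).congr fun n => by
      simp [eval_monomial]

/-- The numeral of a power of two: `k` zeros then a one. [folklore] -/
theorem natE_two_pow (k : ℕ) : natE (2 ^ k) = List.replicate k false ++ [true] := by
  have h : bitsToNat (List.replicate k false ++ [true]) = 2 ^ k := by
    rw [bitsToNat_append, bitsToNat_replicate_false]; simp
  rw [← h]
  exact encodeNat_bitsToNat (isCanonicalNum_append_true _)

/-- A string of `k` zeros (`1ᵏ ↦ 0ᵏ`). [folklore] -/
theorem falses_code : CodeFP unE strE (fun k => List.replicate k false) :=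
  (strTake.comp ((CodeFP.id unE).pair (strOfNat.comp (natPow.comp ((cst unE natE 2).pair (CodeFP.id unE)))))).congr
    fun k => by
      show (natE (2 ^ k)).take k = _
      rw [natE_two_pow]; simp

/-- **Padded numerals** `(t, 1ᴸ) ↦ natPad t L`. [folklore] -/
theorem natPad_code : CodeFP (pairE natE unE) strE (fun p => natPad p.1 p.2) :=
  (strAppend.comp ((strOfNat.comp (fst _ _)).pair (falses_code.comp (unSub.comp ((snd _ _).pair
    (strLength.comp (strOfNat.comp (fst _ _)))))))).congr fun _ => rfl

/-- The bits of a string as one-letter chunks. [folklore] -/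
theorem explode_eq (s : List Bool) : ((List.range s.length).map fun i => decide ((s.drop (i * 1)).take 1 = [true])) = s := by
  apply List.ext_getElem
  · simp
  · intro i h1 h2
    simp only [List.getElem_map, List.getElem_range, Nat.mul_one]
    rw [List.drop_eq_getElem_cons h2, List.take_succ_cons, List.take_zero]
    cases s[i] <;> simp

/-- **The bits of a string** as a raw list of bits (`strChunks` of width `1`). [folklore] -/
theorem explode_code : CodeFP strE (rawE bitE) (fun s => s) := by
  have hinj : Function.Injective strE := fun _ _ h => h
  have hch := strChunks.comp (strLength.pair ((cst strE unE 1).pair (CodeFP.id strE)))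
  have h := (map₀ ((CodeFP.eq hinj).comp ((CodeFP.id strE).pair (cst strE strE [true])))).comp hch
  refine h.congr fun s => ?_
  show ((List.range s.length).map (fun i => (s.drop (i * 1)).take 1)).map (fun a => decide (a = [true])) = s
  rw [List.map_map]
  exact explode_eq s

/-- The code `listE natE l` as a string, from the raw list. [folklore] -/
theorem listStr_code : CodeFP (rawE natE) strE (fun l => listE natE l) :=
  ((ulength natE).pair (CodeFP.id (rawE natE))).recodeOut fun _ => rfl

/-- The code `listE (listE natE) L` as a string, from the raw list of raw lists. [folklore] -/
theorem listListStr_code : CodeFP (rawE (rawE natE)) strE (fun L => listE (listE natE) L) :=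
  ((ulength (rawE natE)).pair (map₀ listStr_code)).recodeOut fun L => by
    simp only [pairE_apply]
    show boolPair (unE L.length) (rawE strE (L.map fun l => listE natE l)) = boolPair (unE L.length) (rawE (listE natE) L)
    rw [rawE, rawE, List.map_map]; rfl

/-- **The total list decoder on strings**: the items of the second pair component. [folklore] -/
theorem decL_code : CodeFP strE (rawE strE) (fun r => decNil (sndF r)) := by
  set step : List Bool → List Bool := fun v => sndPow 1 v ++ fanoutFn (nthF 1) (fun _ => []) v with hstep
  have hFP : step ∈ FP :=
    append_mem_FP (sndPow_mem_FP 1) (fanoutFn_mem_FP (nthF_mem_FP 1) (const_mem_FP []))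
  have hgrowth : FoldGrowth 2 step := fun v => by
    have h1 : sndPow 1 v = sndF (sndF v) := rfl
    have h2 : nthF 1 v = fstF (sndF v) := rfl
    rw [hstep]
    simp only [List.length_append, fanoutFn_apply, length_boolPair, List.length_nil, h1, h2]
    have := length_fstF_sndF_le (sndF v)
    have := length_fstF_sndF_le v
    omega
  refine ⟨foldFn step (fun _ => []), foldFn_mem_FP hFP (const_mem_FP []) hgrowth, fun r => ?_⟩
  rw [foldFn_apply]
  change List.foldl (fun acc a => step (boolPair r (boolPair a acc))) [] (decNil (sndF r)) = rawE strE (decNil (sndF r))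
  have hs : ∀ acc a : List Bool, step (boolPair r (boolPair a acc)) = acc ++ boolPair a [] := by
    intro acc a
    rw [hstep]
    simp [sndPow, nthF]
  rw [show (fun (acc a : List Bool) => step (boolPair r (boolPair a acc))) = fun acc a => acc ++ boolPair a [] from
    funext fun acc => funext fun a => hs acc a, foldl_append_flatMap, List.nil_append]
  rw [rawE, Com.encList_eq_flatMap, List.flatMap_map]
  refine List.flatMap_congr fun a _ => ?_
  simp [boolPair]

/-- **The parser of the guess** on strings. [folklore] -/
theorem parseGuess_code : CodeFP strE (rawE (rawE (rawE natE))) parseGuess :=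
  ((map₀ ((map₀ decStr_code).comp decL_code)).comp decL_code).congr fun _ => rfl

/-! ### The terms in template form -/

section Tmpl

variable (M : TM2ComputableAux Bool Bool)

/-- The number of a block value. [folklore] -/
def vi (v : Val M.tm) : ℕ := ((valEquiv M) v : ℕ)

/-- The numeric literal of a family with offset `φNV = φ · NV`: variable `(b, value number vI)`.
[folklore] -/
def nlit' (φNV V : ℕ) (neg : Bool) (b vI : ℕ) : Lit := (neg, false, φNV + (b * V + vI))

/-- `varLit` is `nlit'`. [folklore] -/
theorem varLit_eq_nlit' (NV φ : ℕ) (neg : Bool) (bv : TVar M) :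
    varLit M NV φ neg bv = nlit' (φ * NV) (Vc M) neg bv.1 (vi M bv.2) := rfl

/-- **The top-rule table** of the machine: for every tuple `a` of `3d + 1` values and `r ≤ 2d`,
the premises `(s, #a s)` and the conclusion `(r, #topF a r)`. [folklore] -/
def topTmpl : List (List (ℕ × ℕ) × (ℕ × ℕ)) :=
  (allTuples M (3 * dM M + 1)).flatMap fun a => (List.finRange (2 * dM M + 1)).map fun (r : Fin (2 * dM M + 1)) =>
    (((List.finRange (3 * dM M + 1)).map fun (s : Fin (3 * dM M + 1)) => ((s : ℕ), vi M (a s))),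
      ((r : ℕ), vi M (topF (dM M) a r)))

/-- **The interior-rule table**: head values, neighbourhood values, conclusion value. [folklore] -/
def intTmpl : List (List (ℕ × ℕ) × List (ℕ × ℕ) × ℕ) :=
  (allTuples M (dM M + 1)).flatMap fun h => (allTuples M (2 * dM M + 1)).map fun nb =>
    (((List.finRange (dM M + 1)).map fun (s : Fin (dM M + 1)) => ((s : ℕ), vi M (h s))),
      ((List.finRange (2 * dM M + 1)).map fun (s : Fin (2 * dM M + 1)) => ((s : ℕ), vi M (nb s))), vi M (intF (dM M) h nb))

open scoped Classical in
/-- **The exactly-one table**: the "some value" clause and the "not two values" clauses. [folklore] -/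
def cellTmpl : List (List ℕ × List ℕ) :=
  ([], (allVals M).map (vi M)) ::
    ((allVals M).flatMap fun v => (allVals M).flatMap fun v' => if v = v' then [] else [([vi M v, vi M v'], [])])

section Pieces

variable (sel : Lit) (φNV RB n' w T : ℕ)

/-- The bit terms of the instance word (bits with their indices). [folklore] -/
def bitsP (ibs : List (ℕ × Bool)) : List (List Lit) :=
  ibs.flatMap fun ib =>
    [[sel, nlit' φNV (Vc M) true (2 * ib.1 + 1) (if ib.2 then vi M (symVal M true) else vi M (symVal M false))],
      [sel, nlit' φNV (Vc M) true (2 * ib.1 + 2) (if ib.2 then vi M (symVal M true) else vi M (symVal M false))]]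

/-- The start terms. [folklore] -/
def startP : List (List Lit) :=
  ([[sel, nlit' φNV (Vc M) true 0 (vi M (ctrlVal M))], [sel, nlit' φNV (Vc M) true (2 * n' + 1) (vi M (symVal M false))],
      [sel, nlit' φNV (Vc M) true (2 * n' + 2) (vi M (symVal M true))]] ++
    (List.range w).flatMap fun j =>
      [[sel, nlit' φNV (Vc M) true (2 * n' + 3 + j) (vi M (symVal M false)),
          nlit' φNV (Vc M) true (2 * n' + 3 + j) (vi M (symVal M true)),
          nlit' φNV (Vc M) true (2 * n' + 3 + j) (vi M (noneVal M.tm))],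
        [sel, nlit' φNV (Vc M) false (2 * n' + 3 + j) (vi M (noneVal M.tm)),
          nlit' φNV (Vc M) true (2 * n' + 4 + j) (vi M (noneVal M.tm))]]) ++
  (List.range (dM M * T + 3 * dM M)).map fun j =>
    [sel, nlit' φNV (Vc M) true (NN n' w + 1 + j) (vi M (noneVal M.tm))]

/-- The top terms of row `t`. [folklore] -/
def topP (t : ℕ) : List (List Lit) :=
  (topTmpl M).map fun e => sel :: ((e.1.map fun sa => nlit' φNV (Vc M) false (t * RB + sa.1) sa.2) ++
    [nlit' φNV (Vc M) true ((t + 1) * RB + e.2.1) e.2.2])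

/-- The interior terms of row `t`, block `2d + 1 + j`. [folklore] -/
def intP (t j : ℕ) : List (List Lit) :=
  (intTmpl M).map fun e => sel :: (((e.1.map fun sh => nlit' φNV (Vc M) false (t * RB + sh.1) sh.2) ++
    (e.2.1.map fun sn => nlit' φNV (Vc M) false (t * RB + (dM M + 1 + j + sn.1)) sn.2)) ++
    [nlit' φNV (Vc M) true ((t + 1) * RB + (2 * dM M + 1 + j)) e.2.2])

/-- The bottom terms of row `t`. [folklore] -/
def botP (t : ℕ) : List (List Lit) :=
  (List.range (dM M)).map fun r =>
    [sel, nlit' φNV (Vc M) true ((t + 1) * RB + (NN n' w + dM M * T + 2 * dM M + 1 + r)) (vi M (noneVal M.tm))]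

/-- The move terms. [folklore] -/
def movesP : List (List Lit) :=
  (List.range T).flatMap fun t => topP M sel φNV RB t ++
    (List.range (NN n' w + dM M * T)).flatMap (intP M sel φNV RB t) ++ botP M sel φNV RB n' w T t

/-- The exactly-one terms of block `J` of row `t`. [folklore] -/
def cellP (t J : ℕ) : List (List Lit) :=
  (cellTmpl M).map fun e => sel :: ((e.1.map fun pv => nlit' φNV (Vc M) false (t * RB + J) pv) ++
    (e.2.map fun cv => nlit' φNV (Vc M) true (t * RB + J) cv))

/-- The exactly-one terms. [folklore] -/
def cellsP : List (List Lit) :=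
  (List.range (T + 1)).flatMap fun t => (List.range (S1 M n' w T + 1)).flatMap (cellP M sel φNV RB t)

/-- The accept term. [folklore] -/
def accP : List (List Lit) := [[sel, nlit' φNV (Vc M) true (T * RB + 1) (vi M (accVal M))]]

/-- The pin terms. [folklore] -/
def pinsP : List (List Lit) :=
  (List.range w).flatMap fun j =>
    [[sel, nlit' φNV (Vc M) true (2 * n' + 3 + j) (vi M (symVal M true)), (false, true, j)],
      [sel, nlit' φNV (Vc M) true (2 * n' + 3 + j) (vi M (symVal M false)), (true, true, j)]]

/-- **All terms of a family in template form** (`n'` for the clauses, `m'` for the pins; both are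
`|x'|` on a genuine family). [folklore] -/
def famTermsP (m' : ℕ) (ibs : List (ℕ × Bool)) : List (List Lit) :=
  (bitsP M sel φNV ibs ++ (((startP M sel φNV n' w T ++ movesP M sel φNV RB n' w T) ++ cellsP M sel φNV RB n' w T) ++
    accP M sel φNV RB T)) ++ pinsP M sel φNV m' w

end Pieces

/-! #### The template pieces are the clause families -/

section Eqs

variable {M} (x' : List Bool) (P T NV rO φ : ℕ)

/-- Bits. [folklore] -/
theorem bits_eq : (xClauses M x'.length P T x').map (clauseTerm M NV rO φ) =
    bitsP M (selLit NV rO φ) (φ * NV) ((List.range x'.length).zip x') := by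
  have hsv : ∀ b : Bool, (if b then vi M (symVal M true) else vi M (symVal M false)) = vi M (symVal M b) := by
    intro b; cases b <;> rfl
  rw [xClauses, List.zipIdx_eq_zip_range', ← List.range_eq_range', bitsP, ← List.zip_swap, List.flatMap_map, List.map_flatMap]
  refine List.flatMap_congr fun ib _ => ?_
  simp [bitClauses, clauseTerm, varLit_eq_nlit', blk, hsv, Prod.swap]

/-- Start. [folklore] -/
theorem start_eq : (startClauses M x'.length P T).map (clauseTerm M NV rO φ) =
    startP M (selLit NV rO φ) (φ * NV) x'.length P T := by
  simp only [startClauses, startP, List.map_append, List.map_cons, List.map_nil, List.map_flatMap, List.map_map]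
  congr 1
  · congr 1
    · simp [clauseTerm, varLit_eq_nlit', blk]
    · refine List.flatMap_congr fun j _ => ?_
      simp [clauseTerm, varLit_eq_nlit', blk]
  · refine List.map_congr_left fun j _ => ?_
    simp [clauseTerm, varLit_eq_nlit', blk]

/-- Top. [folklore] -/
theorem top_eq (t : ℕ) : (topClauses M x'.length P T t).map (clauseTerm M NV rO φ) =
    topP M (selLit NV rO φ) (φ * NV) (RB M x'.length P T) t := by
  simp only [topClauses, topP, topTmpl, List.map_flatMap, List.map_map]
  refine List.flatMap_congr fun a _ => List.map_congr_left fun r _ => ?_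
  simp [clauseTerm, varLit_eq_nlit', blk, Function.comp_def]

/-- Interior. [folklore] -/
theorem int_eq (t j : ℕ) : (intClauses M x'.length P T t j).map (clauseTerm M NV rO φ) =
    intP M (selLit NV rO φ) (φ * NV) (RB M x'.length P T) t j := by
  simp only [intClauses, intP, intTmpl, List.map_flatMap, List.map_map]
  refine List.flatMap_congr fun h _ => List.map_congr_left fun nb _ => ?_
  simp [clauseTerm, varLit_eq_nlit', blk, Function.comp_def]

/-- Bottom. [folklore] -/
theorem bot_eq (t : ℕ) : (botClauses M x'.length P T t).map (clauseTerm M NV rO φ) =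
    botP M (selLit NV rO φ) (φ * NV) (RB M x'.length P T) x'.length P T t := by
  simp only [botClauses, botP, List.map_map]
  refine List.map_congr_left fun r _ => ?_
  simp [clauseTerm, varLit_eq_nlit', blk]

/-- Cells. [folklore] -/
theorem cell_eq (t J : ℕ) : (cellClauses M x'.length P T t J).map (clauseTerm M NV rO φ) =
    cellP M (selLit NV rO φ) (φ * NV) (RB M x'.length P T) t J := by
  classical
  simp only [cellClauses, cellP, cellTmpl, List.map_cons, List.map_flatMap, List.map_map]
  congr 1
  · simp [clauseTerm, varLit_eq_nlit', blk, Function.comp_def]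
  · refine List.flatMap_congr fun v _ => List.flatMap_congr fun v' _ => ?_
    split_ifs <;> simp [clauseTerm, varLit_eq_nlit', blk]

/-- Moves. [folklore] -/
theorem moves_eq : ((List.range T).flatMap fun t => topClauses M x'.length P T t ++
      ((List.range (NN x'.length P + dM M * T)).flatMap fun j => intClauses M x'.length P T t j) ++
      botClauses M x'.length P T t).map (clauseTerm M NV rO φ) =
    movesP M (selLit NV rO φ) (φ * NV) (RB M x'.length P T) x'.length P T := by
  rw [movesP, List.map_flatMap]
  refine List.flatMap_congr fun t _ => ?_
  rw [List.map_append, List.map_append, top_eq, bot_eq, List.map_flatMap,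
    List.flatMap_congr fun j _ => int_eq x' P T NV rO φ t j]

/-- All cells. [folklore] -/
theorem cells_eq : ((List.range (T + 1)).flatMap fun t => (List.range (S1 M x'.length P T + 1)).flatMap fun J =>
      cellClauses M x'.length P T t J).map (clauseTerm M NV rO φ) =
    cellsP M (selLit NV rO φ) (φ * NV) (RB M x'.length P T) x'.length P T := by
  rw [cellsP, List.map_flatMap]
  refine List.flatMap_congr fun t _ => ?_
  rw [List.map_flatMap, List.flatMap_congr fun J _ => cell_eq x' P T NV rO φ t J]

/-- Accept. [folklore] -/
theorem acc_eq : [(([] : List (TVar M)), [(blk M x'.length P T T 1, accVal M)])].map (clauseTerm M NV rO φ) =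
    accP M (selLit NV rO φ) (φ * NV) (RB M x'.length P T) T := by
  simp [accP, clauseTerm, varLit_eq_nlit', blk]

/-- Pins. [folklore] -/
theorem pins_eq (n' : ℕ) : (List.range P).flatMap (pinTerms M NV rO φ n' P T) =
    pinsP M (selLit NV rO φ) (φ * NV) n' P := by
  rw [pinsP]
  refine List.flatMap_congr fun j _ => ?_
  simp [pinTerms, varLit_eq_nlit', blk]

/-- **`famTerms` in template form.** [folklore] -/
theorem famTerms_eq_P (c : ℕ) (pT : Polynomial ℕ) (x : List Bool) (φ' : ℕ) :
    famTerms M c pT x φ' = famTermsP M (selLit (NVn c M pT x.length) (rOut c M pT x.length) φ')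
      (φ' * NVn c M pT x.length)
      (RB M (xq' c x (φ' / 2) (decide (φ' % 2 = 1))).length (succinctWidth c x.length) (TT c pT x.length))
      (xq' c x (φ' / 2) (decide (φ' % 2 = 1))).length (succinctWidth c x.length) (TT c pT x.length) (nX c x.length)
      ((List.range (xq' c x (φ' / 2) (decide (φ' % 2 = 1))).length).zip (xq' c x (φ' / 2) (decide (φ' % 2 = 1)))) := by
  rw [famTerms, clauses, nClauses, List.map_append, List.map_append, List.map_append, List.map_append, bits_eq, start_eq,
    moves_eq, cells_eq, acc_eq, famTermsP, pins_eq]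

end Eqs

end Tmpl


/-! ### The numerology of the input in the calculus -/

section Ctx

variable (c : ℕ) (M : TM2ComputableAux Bool Bool) (pT : Polynomial ℕ)

/-- **The context of an input `x`**: `(x, 1ʷ, 1^{|x'|}, 1ᵀ, RB, NV, rOut)` (the three lengths in
unary, so that the ranges of the generator need no budget). [folklore] -/
def ctxOf (x : List Bool) : List Bool × ℕ × ℕ × ℕ × ℕ × ℕ × ℕ :=
  (x, succinctWidth c x.length, nX c x.length, TT c pT x.length, RBn c M pT x.length, NVn c M pT x.length,
    rOut c M pT x.length)

/-- The code of a context. [folklore] -/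
abbrev ctxE : List Bool × ℕ × ℕ × ℕ × ℕ × ℕ × ℕ → List Bool :=
  pairE strE (pairE unE (pairE unE (pairE unE (pairE natE (pairE natE natE)))))

/-- The width in binary from the length in unary: `1ⁿ ↦ n + c log₂ n + c`. [folklore] -/
theorem width_code : CodeFP unE natE (fun n => succinctWidth c n) := by
  have hlog := natLog2Min.comp (natOfUn.pair replicateUnit)
  have h := natAdd.comp ((natAdd.comp (natOfUn.pair (natMul.comp ((cst unE natE c).pair hlog)))).pair (cst unE natE c))
  refine h.congr fun n => ?_
  simp [succinctWidth, min_eq_right (Nat.log_le_self 2 n)]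

/-- The width in unary (capped by `(c + 1) n + c`, which it never exceeds). [folklore] -/
theorem widthU_code : CodeFP unE unE (fun n => succinctWidth c n) := by
  have hb := unPoly_code (Polynomial.C (c + 1) * X + Polynomial.C c)
  have h := unOfNatMin.comp (hb.pair (width_code c))
  refine h.congr fun n => ?_
  have := MachineB.succinctWidth_le_widthPoly c n
  rw [MachineB.widthPoly] at this
  exact min_eq_left this

/-- `|x'| = 2n + 2w + 21` in unary. [folklore] -/
theorem nXU_code : CodeFP unE unE (fun n => nX c n) := by
  have hw := widthU_code c
  have h := unAdd.comp ((unAdd.comp ((unMul.comp ((cst unE unE 2).pair (CodeFP.id unE))).pair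
    (unMul.comp ((cst unE unE 2).pair hw)))).pair (cst unE unE 21))
  exact h.congr fun n => by simp [nX]

/-- `T` in unary. [folklore] -/
theorem TTU_code : CodeFP unE unE (fun n => TT c pT n) := by
  have h := (unPoly_code pT).comp ((unAdd.comp ((unAdd.comp ((unMul.comp ((cst unE unE 2).pair (nXU_code c))).pair
    (cst unE unE 2))).pair (widthU_code c))))
  exact h.congr fun n => by simp [TT]

/-- `S₁` in unary. [folklore] -/
theorem S1U_code : CodeFP unE unE (fun n => S1 M (nX c n) (succinctWidth c n) (TT c pT n)) := by
  have h := unAdd.comp ((unAdd.comp ((unAdd.comp ((unAdd.comp ((unMul.comp ((cst unE unE 2).pair (nXU_code c))).pair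
    (cst unE unE 2))).pair (widthU_code c))).pair (unMul.comp ((cst unE unE (dM M)).pair (TTU_code c pT))))).pair
    (cst unE unE (3 * dM M)))
  exact h.congr fun n => by simp [S1, NN]

/-- **The context is computed from `x`.** [folklore] -/
theorem ctxOf_code : CodeFP strE ctxE (ctxOf c M pT) := by
  have hn : CodeFP strE unE List.length := strLength
  have hwU := (widthU_code c).comp hn
  have hnXU := (nXU_code c).comp hn
  have hTU := (TTU_code c pT).comp hn
  have hT := natOfUn.comp hTU
  have hRB := natAdd.comp (((natOfUn.comp (S1U_code c M pT)).comp hn).pair (cst strE natE 1))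
  have hNV := natMul.comp ((natMul.comp ((natAdd.comp (hT.pair (cst strE natE 1))).pair hRB)).pair (cst strE natE (Vc M)))
  have hrO := natAdd.comp ((natMul.comp ((natAdd.comp ((natMul.comp (hT.pair hRB)).pair (cst strE natE 1))).pair
    (cst strE natE (Vc M)))).pair (cst strE natE (((valEquiv M) (accVal M) : ℕ))))
  have h := (CodeFP.id strE).pair (hwU.pair (hnXU.pair (hTU.pair (hRB.pair (hNV.pair hrO)))))
  exact h.congr fun x => by simp [ctxOf, RBn, RB, NVn, Rn, rOut, rIdx, outVar, blk, Vc]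

end Ctx

/-! ### The family context and the terms as a function of it -/

section FamCtx

variable (M : TM2ComputableAux Bool Bool)

/-- The instance word from the width: `⟨x, ⟨⟨bin₂ (p / (w+2)), bin_{w+2} (p % (w+2))⟩, [pol]⟩⟩`. [folklore] -/
def xqW (x : List Bool) (w p : ℕ) (pol : Bool) : List Bool :=
  boolPair x (boolPair (boolPair (natPad (p / (w + 2)) 2) (natPad (p % (w + 2)) (w + 2))) [pol])

/-- `xq'` is `xqW` at the width. [folklore] -/
theorem xq'_eq_xqW (c : ℕ) (x : List Bool) (p : ℕ) (pol : Bool) : xq' c x p pol = xqW x (succinctWidth c x.length) p pol := rfl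

/-- **The context of family `φ`** from the context `g.1` of `x` and `φ = g.2`: guard literal,
offset `φ · NV`, `RB`, instance word `x'`, and `1ʷ`, `1^{|x'|}`, `1ᵀ`. [folklore] -/
def famCtxOf (g : (List Bool × ℕ × ℕ × ℕ × ℕ × ℕ × ℕ) × ℕ) : Lit × ℕ × ℕ × List Bool × ℕ × ℕ × ℕ :=
  (selLit g.1.2.2.2.2.2.1 g.1.2.2.2.2.2.2 g.2, g.2 * g.1.2.2.2.2.2.1, g.1.2.2.2.2.1,
    xqW g.1.1 g.1.2.1 (g.2 / 2) (decide (g.2 % 2 = 1)), g.1.2.1, g.1.2.2.1, g.1.2.2.2.1)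

/-- The code of a literal. [folklore] -/
abbrev litE : Lit → List Bool := pairE bitE (pairE bitE natE)

/-- The code of a family context. [folklore] -/
abbrev famE : Lit × ℕ × ℕ × List Bool × ℕ × ℕ × ℕ → List Bool :=
  pairE litE (pairE natE (pairE natE (pairE strE (pairE unE (pairE unE unE)))))

/-- **The family context is computed.** [folklore] -/
theorem famCtxOf_code : CodeFP (pairE ctxE natE) famE famCtxOf := by
  have hφ : CodeFP (pairE ctxE natE) natE (fun g => g.2) := snd _ _
  have hctx : CodeFP (pairE ctxE natE) ctxE (fun g => g.1) := fst _ _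
  have hx := hctx.fst'
  have hwU := hctx.snd'.fst'
  have hnXU := hctx.snd'.snd'.fst'
  have hTU := hctx.snd'.snd'.snd'.fst'
  have hRB := hctx.snd'.snd'.snd'.snd'.fst'
  have hNV := hctx.snd'.snd'.snd'.snd'.snd'.fst'
  have hrO := hctx.snd'.snd'.snd'.snd'.snd'.snd'
  -- the guard literal `(φ odd, 0, φ/2·2·NV + rOut)`
  have hodd := natEq.comp ((natMod.comp (hφ.pair (cst _ natE 2))).pair (cst _ natE 1))
  have hhalf := natDiv.comp (hφ.pair (cst _ natE 2))
  have hsel := hodd.pair ((cst (pairE ctxE natE) bitE false).pair (natAdd.comp ((natMul.comp ((natMul.comp (hhalf.pair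
    (cst _ natE 2))).pair hNV)).pair hrO)))
  -- the instance word
  have hw2 := natAdd.comp ((natOfUn.comp hwU).pair (cst _ natE 2))
  have hw2U := unAdd.comp (hwU.pair (cst _ unE 2))
  have hp1 := natPad_code.comp ((natDiv.comp (hhalf.pair hw2)).pair (cst (pairE ctxE natE) unE 2))
  have hp2 := natPad_code.comp ((natMod.comp (hhalf.pair hw2)).pair hw2U)
  have hx' : CodeFP (pairE ctxE natE) strE (fun g => xqW g.1.1 g.1.2.1 (g.2 / 2) (decide (g.2 % 2 = 1))) :=
    (hx.pair ((hp1.pair hp2).pair hodd)).recodeOut fun g => by simp [xqW, bitE, id]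
  have h := hsel.pair ((natMul.comp (hφ.pair hNV)).pair (hRB.pair (hx'.pair (hwU.pair (hnXU.pair hTU)))))
  exact h.congr fun g => by simp [famCtxOf, selLit]

end FamCtx

/-! ### Generic list builders in the calculus -/

section Builders

variable {σ α β : Type} {eσ : σ → List Bool} {eα : α → List Bool} {eβ : β → List Bool}

/-- Cons of computed head and tail. [folklore] -/
theorem cons' {a : σ → α} {l : σ → List α} (ha : CodeFP eσ eα a) (hl : CodeFP eσ (rawE eα) l) :
    CodeFP eσ (rawE eα) (fun s => a s :: l s) :=
  ((rawCons eα).comp (ha.pair hl)).congr fun _ => rfl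

/-- The empty list. [folklore] -/
theorem nil' (eσ : σ → List Bool) (eα : α → List Bool) : CodeFP eσ (rawE eα) (fun _ => ([] : List α)) :=
  cst eσ (rawE eα) []

/-- Append of computed lists. [folklore] -/
theorem app' {a b : σ → List α} (ha : CodeFP eσ (rawE eα) a) (hb : CodeFP eσ (rawE eα) b) :
    CodeFP eσ (rawE eα) (fun s => a s ++ b s) :=
  ((rawAppend eα).comp (ha.pair hb)).congr fun _ => rfl

/-- Map with the whole input as context. [folklore] -/
theorem map' {l : σ → List α} {g : σ × α → β} (hg : CodeFP (pairE eσ eα) eβ g) (hl : CodeFP eσ (rawE eα) l) :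
    CodeFP eσ (rawE eβ) (fun s => (l s).map fun a => g (s, a)) :=
  ((map hg).comp ((CodeFP.id eσ).pair hl)).congr fun _ => rfl

/-- FlatMap with the whole input as context. [folklore] -/
theorem flatMap' {l : σ → List α} {g : σ × α → List β} (hg : CodeFP (pairE eσ eα) (rawE eβ) g)
    (hl : CodeFP eσ (rawE eα) l) : CodeFP eσ (rawE eβ) (fun s => (l s).flatMap fun a => g (s, a)) :=
  ((flatten eβ).comp (map' hg hl)).congr fun s => by simp [List.flatMap_def]

/-- The range of a computed unary numeral. [folklore] -/
theorem urange' {k : σ → ℕ} (hk : CodeFP eσ unE k) : CodeFP eσ (rawE natE) (fun s => List.range (k s)) :=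
  (urange.comp hk).congr fun _ => rfl

/-- A singleton list. [folklore] -/
theorem single' {a : σ → α} (ha : CodeFP eσ eα a) : CodeFP eσ (rawE eα) (fun s => [a s]) :=
  cons' ha (nil' eσ eα)

end Builders

/-! ### The terms as a function of the family context, in the calculus -/

section FamTerms

variable (M : TM2ComputableAux Bool Bool)

/-- **The terms of a family as a function of its context** `f = (sel, φNV, RB, x', 1ʷ, 1^{n'}, 1ᵀ)`.
[folklore] -/
def famTerms'' (f : Lit × ℕ × ℕ × List Bool × ℕ × ℕ × ℕ) : List (List Lit) :=
  famTermsP M f.1 f.2.1 f.2.2.1 f.2.2.2.2.2.1 f.2.2.2.2.1 f.2.2.2.2.2.2 f.2.2.2.2.2.1 ((List.range f.2.2.2.1.length).zip f.2.2.2.1)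

variable {M}

/-- **The context form is the term list** on the context of a family of `x`. [folklore] -/
theorem famTerms''_of (c : ℕ) (pT : Polynomial ℕ) (x : List Bool) {φ : ℕ} (hφ : φ < nFam c x.length) :
    famTerms'' M (famCtxOf (ctxOf c M pT x, φ)) = famTerms M c pT x φ := by
  have hp : φ / 2 < 3 * (succinctWidth c x.length + 2) := by unfold nFam at hφ; omega
  have hlen := length_xq' c x hp (decide (φ % 2 = 1))
  rw [famTerms_eq_P, famTerms'', famCtxOf, ctxOf]
  simp only [← xq'_eq_xqW, hlen]
  rfl

/-- The code of a numeric literal `(φNV, neg, b, vI) ↦ nlit' φNV V neg b vI`. [folklore] -/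
theorem nlit'_code (V : ℕ) : CodeFP (pairE natE (pairE bitE (pairE natE natE))) litE (fun p => nlit' p.1 V p.2.1 p.2.2.1 p.2.2.2) := by
  have hNV : CodeFP (pairE natE (pairE bitE (pairE natE natE))) natE (fun p => p.1) := fst _ _
  have hng : CodeFP (pairE natE (pairE bitE (pairE natE natE))) bitE (fun p => p.2.1) := p21 _ _ _
  have hb : CodeFP (pairE natE (pairE bitE (pairE natE natE))) natE (fun p => p.2.2.1) := (p22 _ _ _).fst'
  have hv : CodeFP (pairE natE (pairE bitE (pairE natE natE))) natE (fun p => p.2.2.2) := (p22 _ _ _).snd'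
  have h := hng.pair ((cst _ bitE false).pair (natAdd.comp (hNV.pair (natAdd.comp ((natMul.comp (hb.pair (cst _ natE V))).pair hv)))))
  exact h.congr fun p => rfl

/-- A literal from computed offset, block and value number. [folklore] -/
theorem mkLit {σ : Type} {eσ : σ → List Bool} {φNV b vI : σ → ℕ} (V : ℕ) (neg : Bool) (h1 : CodeFP eσ natE φNV)
    (h2 : CodeFP eσ natE b) (h3 : CodeFP eσ natE vI) : CodeFP eσ litE (fun s => nlit' (φNV s) V neg (b s) (vI s)) :=
  ((nlit'_code V).comp (h1.pair ((cst eσ bitE neg).pair (h2.pair h3)))).congr fun _ => rfl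

/-- An input literal `(ng, 1, j)` from a computed `j`. [folklore] -/
theorem mkIn {σ : Type} {eσ : σ → List Bool} {j : σ → ℕ} (ng : Bool) (hj : CodeFP eσ natE j) :
    CodeFP eσ litE (fun s => ((ng, true, j s) : Lit)) :=
  ((cst eσ bitE ng).pair ((cst eσ bitE true).pair hj)).congr fun _ => rfl

/-- The code of the top table entries. [folklore] -/
abbrev topE : List (ℕ × ℕ) × (ℕ × ℕ) → List Bool := pairE (rawE (pairE natE natE)) (pairE natE natE)

/-- The code of the interior table entries. [folklore] -/
abbrev intE : List (ℕ × ℕ) × List (ℕ × ℕ) × ℕ → List Bool := pairE (rawE (pairE natE natE)) (pairE (rawE (pairE natE natE)) natE)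

/-- The code of the exactly-one table entries. [folklore] -/
abbrev cellE : List ℕ × List ℕ → List Bool := pairE (rawE natE) (rawE natE)

/-- **The terms of a family are computed from its context.** [cite: AroraBarakCC2009, §1.3] -/
theorem famTerms''_code : CodeFP famE (rawE (rawE litE)) (famTerms'' M) := by
  -- fields of the family context
  have fSel : CodeFP famE litE (fun f => f.1) := fst _ _
  have fNV : CodeFP famE natE (fun f => f.2.1) := p21 _ _ _
  have fRB : CodeFP famE natE (fun f => f.2.2.1) := (p22 _ _ _).fst'
  have fX : CodeFP famE strE (fun f => f.2.2.2.1) := (p22 _ _ _).snd'.fst'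
  have fW : CodeFP famE unE (fun f => f.2.2.2.2.1) := (p22 _ _ _).snd'.snd'.fst'
  have fN : CodeFP famE unE (fun f => f.2.2.2.2.2.1) := (p22 _ _ _).snd'.snd'.snd'.fst'
  have fT : CodeFP famE unE (fun f => f.2.2.2.2.2.2) := (p22 _ _ _).snd'.snd'.snd'.snd'
  have fn' := natOfUn.comp fN
  have fw := natOfUn.comp fW
  have ft := natOfUn.comp fT
  have fNN := natAdd.comp ((natAdd.comp ((natMul.comp ((cst famE natE 2).pair fn')).pair (cst famE natE 2))).pair fw)
  have fNNU := unAdd.comp ((unAdd.comp ((unMul.comp ((cst famE unE 2).pair fN)).pair (cst famE unE 2))).pair fW)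
  have fdTU := unMul.comp ((cst famE unE (dM M)).pair fT)
  have fdT := natOfUn.comp fdTU
  -- ### bits of `x'`
  have henum := (rawEnum bitE).comp (explode_code.comp fX)
  have hP1 : CodeFP famE (rawE (rawE litE)) (fun f => ((List.range f.2.2.2.1.length).zip f.2.2.2.1).flatMap fun ib =>
      [[f.1, nlit' f.2.1 (Vc M) true (2 * ib.1 + 1) (if ib.2 then vi M (symVal M true) else vi M (symVal M false))],
        [f.1, nlit' f.2.1 (Vc M) true (2 * ib.1 + 2) (if ib.2 then vi M (symVal M true) else vi M (symVal M false))]]) := by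
    have gf : CodeFP (pairE famE (pairE natE bitE)) famE (fun q => q.1) := fst _ _
    have gi : CodeFP (pairE famE (pairE natE bitE)) natE (fun q => q.2.1) := p21 _ _ _
    have gb : CodeFP (pairE famE (pairE natE bitE)) bitE (fun q => q.2.2) := p22 _ _ _
    have gsv := gb.ite (cst _ natE (vi M (symVal M true))) (cst _ natE (vi M (symVal M false)))
    have g2i := natMul.comp ((cst _ natE 2).pair gi)
    have l1 := mkLit (Vc M) true (fNV.comp gf) (natAdd.comp (g2i.pair (cst _ natE 1))) gsv
    have l2 := mkLit (Vc M) true (fNV.comp gf) (natAdd.comp (g2i.pair (cst _ natE 2))) gsv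
    have body := cons' (cons' (fSel.comp gf) (single' l1)) (single' (cons' (fSel.comp gf) (single' l2)))
    exact (flatMap' body henum).congr fun f => rfl
  -- ### start clauses
  have hP2 : CodeFP famE (rawE (rawE litE)) (fun f =>
      ([[f.1, nlit' f.2.1 (Vc M) true 0 (vi M (ctrlVal M))],
        [f.1, nlit' f.2.1 (Vc M) true (2 * f.2.2.2.2.2.1 + 1) (vi M (symVal M false))],
        [f.1, nlit' f.2.1 (Vc M) true (2 * f.2.2.2.2.2.1 + 2) (vi M (symVal M true))]] ++
      (List.range f.2.2.2.2.1).flatMap (fun j =>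
        [[f.1, nlit' f.2.1 (Vc M) true (2 * f.2.2.2.2.2.1 + 3 + j) (vi M (symVal M false)),
            nlit' f.2.1 (Vc M) true (2 * f.2.2.2.2.2.1 + 3 + j) (vi M (symVal M true)),
            nlit' f.2.1 (Vc M) true (2 * f.2.2.2.2.2.1 + 3 + j) (vi M (noneVal M.tm))],
          [f.1, nlit' f.2.1 (Vc M) false (2 * f.2.2.2.2.2.1 + 3 + j) (vi M (noneVal M.tm)),
            nlit' f.2.1 (Vc M) true (2 * f.2.2.2.2.2.1 + 4 + j) (vi M (noneVal M.tm))]]) ++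
      (List.range (dM M * f.2.2.2.2.2.2 + 3 * dM M)).map (fun j =>
        [f.1, nlit' f.2.1 (Vc M) true (NN f.2.2.2.2.2.1 f.2.2.2.2.1 + 1 + j) (vi M (noneVal M.tm))]))) := by
    have f2n := natMul.comp ((cst famE natE 2).pair fn')
    have t1 := cons' fSel (single' (mkLit (Vc M) true fNV (cst famE natE 0) (cst famE natE (vi M (ctrlVal M)))))
    have t2 := cons' fSel (single' (mkLit (Vc M) true fNV (natAdd.comp (f2n.pair (cst famE natE 1)))
      (cst famE natE (vi M (symVal M false)))))
    have t3 := cons' fSel (single' (mkLit (Vc M) true fNV (natAdd.comp (f2n.pair (cst famE natE 2)))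
      (cst famE natE (vi M (symVal M true)))))
    have l3 := cons' t1 (cons' t2 (single' t3))
    -- the certificate cells
    have gf : CodeFP (pairE famE natE) famE (fun q => q.1) := fst _ _
    have gj : CodeFP (pairE famE natE) natE (fun q => q.2) := snd _ _
    have g2n := natMul.comp ((cst _ natE 2).pair (fn'.comp gf))
    have gb3 := natAdd.comp ((natAdd.comp (g2n.pair (cst _ natE 3))).pair gj)
    have gb4 := natAdd.comp ((natAdd.comp (g2n.pair (cst _ natE 4))).pair gj)
    have u1 := cons' (fSel.comp gf) (cons' (mkLit (Vc M) true (fNV.comp gf) gb3 (cst _ natE (vi M (symVal M false))))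
      (cons' (mkLit (Vc M) true (fNV.comp gf) gb3 (cst _ natE (vi M (symVal M true))))
        (single' (mkLit (Vc M) true (fNV.comp gf) gb3 (cst _ natE (vi M (noneVal M.tm)))))))
    have u2 := cons' (fSel.comp gf) (cons' (mkLit (Vc M) false (fNV.comp gf) gb3 (cst _ natE (vi M (noneVal M.tm))))
      (single' (mkLit (Vc M) true (fNV.comp gf) gb4 (cst _ natE (vi M (noneVal M.tm))))))
    have sw := flatMap' (cons' u1 (single' u2)) (urange' fW)
    -- the empties
    have ge := cons' (fSel.comp gf) (single' (mkLit (Vc M) true (fNV.comp gf)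
      (natAdd.comp ((natAdd.comp ((fNN.comp gf).pair (cst _ natE 1))).pair gj)) (cst _ natE (vi M (noneVal M.tm)))))
    have se := map' ge (urange' (unAdd.comp (fdTU.pair (cst famE unE (3 * dM M)))))
    exact (app' (app' l3 sw) se).congr fun f => rfl
  -- ### moves: context `(f, t)`
  have hP3 : CodeFP famE (rawE (rawE litE)) (fun f => movesP M f.1 f.2.1 f.2.2.1 f.2.2.2.2.2.1 f.2.2.2.2.1 f.2.2.2.2.2.2) := by
    -- row context projections
    have rf : CodeFP (pairE famE natE) famE (fun q => q.1) := fst _ _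
    have rt : CodeFP (pairE famE natE) natE (fun q => q.2) := snd _ _
    have rSel := fSel.comp rf
    have rNV := fNV.comp rf
    have rRB := fRB.comp rf
    have rtRB := natMul.comp (rt.pair rRB)
    have rt1RB := natMul.comp ((natAdd.comp (rt.pair (cst _ natE 1))).pair rRB)
    -- top: context `((f, t), e)`, `e : topE`
    have hA : CodeFP (pairE famE natE) (rawE (rawE litE)) (fun q => topP M q.1.1 q.1.2.1 q.1.2.2.1 q.2) := by
      have aρ : CodeFP (pairE (pairE famE natE) topE) (pairE famE natE) (fun q => q.1) := fst _ _
      have ae : CodeFP (pairE (pairE famE natE) topE) topE (fun q => q.2) := snd _ _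
      have pρ : CodeFP (pairE (pairE (pairE famE natE) topE) (pairE natE natE)) (pairE famE natE) (fun q => q.1.1) := p11 _ _ _
      have psa : CodeFP (pairE (pairE (pairE famE natE) topE) (pairE natE natE)) (pairE natE natE) (fun q => q.2) := snd _ _
      have plit := mkLit (Vc M) false (rNV.comp pρ) (natAdd.comp ((rtRB.comp pρ).pair psa.fst')) psa.snd'
      have prem := map' plit ae.fst'
      have conc := mkLit (Vc M) true (rNV.comp aρ) (natAdd.comp ((rt1RB.comp aρ).pair ae.snd'.fst')) ae.snd'.snd'
      have body := cons' (rSel.comp aρ) (app' prem (single' conc))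
      exact (map' body (cst (pairE famE natE) (rawE topE) (topTmpl M))).congr fun q => rfl
    -- interior: context `((f, t), j)`, then `e : intE`, then the entries
    have hB : CodeFP (pairE famE natE) (rawE (rawE litE)) (fun q =>
        (List.range (NN q.1.2.2.2.2.2.1 q.1.2.2.2.2.1 + dM M * q.1.2.2.2.2.2.2)).flatMap
          (intP M q.1.1 q.1.2.1 q.1.2.2.1 q.2)) := by
      have bρ : CodeFP (pairE (pairE famE natE) natE) (pairE famE natE) (fun q => q.1) := fst _ _
      have bj : CodeFP (pairE (pairE famE natE) natE) natE (fun q => q.2) := snd _ _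
      have cρj : CodeFP (pairE (pairE (pairE famE natE) natE) intE) (pairE (pairE famE natE) natE) (fun q => q.1) := fst _ _
      have ce : CodeFP (pairE (pairE (pairE famE natE) natE) intE) intE (fun q => q.2) := snd _ _
      have dρj : CodeFP (pairE (pairE (pairE (pairE famE natE) natE) intE) (pairE natE natE)) (pairE (pairE famE natE) natE)
          (fun q => q.1.1) := p11 _ _ _
      have dsh : CodeFP (pairE (pairE (pairE (pairE famE natE) natE) intE) (pairE natE natE)) (pairE natE natE)
          (fun q => q.2) := snd _ _
      have hlit := mkLit (Vc M) false (rNV.comp (bρ.comp dρj)) (natAdd.comp ((rtRB.comp (bρ.comp dρj)).pair dsh.fst')) dsh.snd'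
      have heads := map' hlit ce.fst'
      have nlitc := mkLit (Vc M) false (rNV.comp (bρ.comp dρj)) (natAdd.comp ((rtRB.comp (bρ.comp dρj)).pair
        (natAdd.comp ((natAdd.comp ((natAdd.comp ((cst _ natE (dM M)).pair (cst _ natE 1))).pair (bj.comp dρj))).pair
          dsh.fst')))) dsh.snd'
      have nbrs := map' nlitc ce.snd'.fst'
      have conc := mkLit (Vc M) true (rNV.comp (bρ.comp cρj)) (natAdd.comp ((rt1RB.comp (bρ.comp cρj)).pair
        (natAdd.comp ((natAdd.comp ((natMul.comp ((cst _ natE 2).pair (cst _ natE (dM M)))).pair (cst _ natE 1))).pair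
          (bj.comp cρj))))) ce.snd'.snd'
      have body := cons' (rSel.comp (bρ.comp cρj)) (app' (app' heads nbrs) (single' conc))
      have perJ := map' body (cst (pairE (pairE famE natE) natE) (rawE intE) (intTmpl M))
      have hK := unAdd.comp ((fNNU.comp rf).pair (fdTU.comp rf))
      exact (flatMap' perJ (urange' hK)).congr fun q => rfl
    -- bottom: context `((f, t), r)`
    have hC : CodeFP (pairE famE natE) (rawE (rawE litE)) (fun q =>
        botP M q.1.1 q.1.2.1 q.1.2.2.1 q.1.2.2.2.2.2.1 q.1.2.2.2.2.1 q.1.2.2.2.2.2.2 q.2) := by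
      have bρ : CodeFP (pairE (pairE famE natE) natE) (pairE famE natE) (fun q => q.1) := fst _ _
      have br : CodeFP (pairE (pairE famE natE) natE) natE (fun q => q.2) := snd _ _
      have hK0 := natAdd.comp ((natAdd.comp ((natAdd.comp ((natAdd.comp (((fNN.comp rf).comp bρ).pair ((fdT.comp rf).comp bρ))).pair
        (natMul.comp ((cst _ natE 2).pair (cst _ natE (dM M)))))).pair (cst _ natE 1))).pair br)
      have lit := mkLit (Vc M) true (rNV.comp bρ) (natAdd.comp ((rt1RB.comp bρ).pair hK0)) (cst _ natE (vi M (noneVal M.tm)))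
      have body := cons' (rSel.comp bρ) (single' lit)
      exact (map' body (cst (pairE famE natE) (rawE natE) (List.range (dM M)))).congr fun q => rfl
    exact (flatMap' (app' (app' hA hB) hC) (urange' fT)).congr fun f => rfl
  -- ### cells: context `(f, t)`, then `((f, t), J)`, then `e : cellE`
  have hP4 : CodeFP famE (rawE (rawE litE)) (fun f => cellsP M f.1 f.2.1 f.2.2.1 f.2.2.2.2.2.1 f.2.2.2.2.1 f.2.2.2.2.2.2) := by
    have rf : CodeFP (pairE famE natE) famE (fun q => q.1) := fst _ _
    have rt : CodeFP (pairE famE natE) natE (fun q => q.2) := snd _ _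
    have bρ : CodeFP (pairE (pairE famE natE) natE) (pairE famE natE) (fun q => q.1) := fst _ _
    have bJ : CodeFP (pairE (pairE famE natE) natE) natE (fun q => q.2) := snd _ _
    have btRBJ := natAdd.comp ((natMul.comp ((rt.comp bρ).pair ((fRB.comp rf).comp bρ))).pair bJ)
    have cρ : CodeFP (pairE (pairE (pairE famE natE) natE) cellE) (pairE (pairE famE natE) natE) (fun q => q.1) := fst _ _
    have ce : CodeFP (pairE (pairE (pairE famE natE) natE) cellE) cellE (fun q => q.2) := snd _ _
    have dρ : CodeFP (pairE (pairE (pairE (pairE famE natE) natE) cellE) natE) (pairE (pairE famE natE) natE) (fun q => q.1.1) :=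
      p11 _ _ _
    have dv : CodeFP (pairE (pairE (pairE (pairE famE natE) natE) cellE) natE) natE (fun q => q.2) := snd _ _
    have plit := mkLit (Vc M) false (((fNV.comp rf).comp bρ).comp dρ) (btRBJ.comp dρ) dv
    have clit := mkLit (Vc M) true (((fNV.comp rf).comp bρ).comp dρ) (btRBJ.comp dρ) dv
    have body := cons' (((fSel.comp rf).comp bρ).comp cρ) (app' (map' plit ce.fst') (map' clit ce.snd'))
    have perJ := map' body (cst (pairE (pairE famE natE) natE) (rawE cellE) (cellTmpl M))
    -- `S₁ + 1` in unary from `f`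
    have hS1U := unAdd.comp ((unAdd.comp ((unAdd.comp (fNNU.pair fdTU)).pair (cst famE unE (3 * dM M)))).pair (cst famE unE 1))
    have perT := flatMap' perJ (urange' (hS1U.comp rf))
    exact (flatMap' perT (urange' (unAdd.comp (fT.pair (cst famE unE 1))))).congr fun f => by
      simp only [cellsP, S1, NN]
      rfl
  -- ### accept and pins
  have hP5 : CodeFP famE (rawE (rawE litE)) (fun f => accP M f.1 f.2.1 f.2.2.1 f.2.2.2.2.2.2) := by
    have lit := mkLit (Vc M) true fNV (natAdd.comp ((natMul.comp (ft.pair fRB)).pair (cst famE natE 1))) (cst famE natE (vi M (accVal M)))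
    exact (single' (cons' fSel (single' lit))).congr fun f => rfl
  have hP6 : CodeFP famE (rawE (rawE litE)) (fun f => pinsP M f.1 f.2.1 f.2.2.2.2.2.1 f.2.2.2.2.1) := by
    have gf : CodeFP (pairE famE natE) famE (fun q => q.1) := fst _ _
    have gj : CodeFP (pairE famE natE) natE (fun q => q.2) := snd _ _
    have gb3 := natAdd.comp ((natAdd.comp ((natMul.comp ((cst _ natE 2).pair (fn'.comp gf))).pair (cst _ natE 3))).pair gj)
    have u1 := cons' (fSel.comp gf) (cons' (mkLit (Vc M) true (fNV.comp gf) gb3 (cst _ natE (vi M (symVal M true))))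
      (single' (mkIn false gj)))
    have u2 := cons' (fSel.comp gf) (cons' (mkLit (Vc M) true (fNV.comp gf) gb3 (cst _ natE (vi M (symVal M false))))
      (single' (mkIn true gj)))
    exact (flatMap' (cons' u1 (single' u2)) (urange' fW)).congr fun f => rfl
  -- ### assembly
  have h := app' (app' hP1 (app' (app' (app' hP2 hP3) hP4) hP5)) hP6
  exact h.congr fun f => rfl

end FamTerms


/-! ### All terms from the context -/

section AllTerms

variable (M : TM2ComputableAux Bool Bool)

/-- All terms as a function of the context record. [folklore] -/
def allTermsG (g : List Bool × ℕ × ℕ × ℕ × ℕ × ℕ × ℕ) : List (List Lit) :=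
  (List.range (2 * (3 * (g.2.1 + 2)))).flatMap fun φ => famTerms'' M (famCtxOf (g, φ))

variable {M}

/-- On the context of `x` these are all terms. [folklore] -/
theorem allTermsG_ctxOf (c : ℕ) (pT : Polynomial ℕ) (x : List Bool) : allTermsG M (ctxOf c M pT x) = allTerms M c pT x := by
  rw [allTermsG, allTerms]
  refine List.flatMap_congr fun φ hφ => ?_
  exact famTerms''_of c pT x (List.mem_range.1 hφ)

/-- `all` with the whole input as context. [folklore] -/
theorem all' {σ α : Type} {eσ : σ → List Bool} {eα : α → List Bool} {l : σ → List α} {p : σ × α → Bool}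
    (hp : CodeFP (pairE eσ eα) bitE p) (hl : CodeFP eσ (rawE eα) l) : CodeFP eσ bitE (fun s => (l s).all fun a => p (s, a)) :=
  ((all hp).comp ((CodeFP.id eσ).pair hl)).congr fun _ => rfl

variable (M) in
/-- **All terms are computed from the context.** [folklore] -/
theorem allTermsG_code : CodeFP ctxE (rawE (rawE litE)) (allTermsG M) := by
  have hwU : CodeFP ctxE unE (fun g => g.2.1) := p21 _ _ _
  have hnF := unMul.comp ((cst ctxE unE 2).pair (unMul.comp ((cst ctxE unE 3).pair (unAdd.comp (hwU.pair (cst ctxE unE 2))))))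
  exact (flatMap' ((famTerms''_code (M := M)).comp famCtxOf_code) (urange' hnF)).congr fun g => rfl

end AllTerms

/-! ### Validation and the block codes -/

section Blocks

/-- The deserialised circuit code: flag, inputs, output wire, gates. [folklore] -/
abbrev desE : Bool × ℕ × WireC × List GateC → List Bool := pairE bitE (pairE natE (pairE wireE (rawE gateE)))

/-- `codeOK w dE sz l` on codes: input `((w, sz), l)`. [folklore] -/
theorem codeOK_code (dE : ℕ) : CodeFP (pairE (pairE natE natE) (rawE natE)) bitE (fun q => codeOK q.1.1 dE q.1.2 q.2) := by
  have hw : CodeFP (pairE (pairE natE natE) (rawE natE)) natE (fun q => q.1.1) := p11 _ _ _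
  have hsz : CodeFP (pairE (pairE natE natE) (rawE natE)) natE (fun q => q.1.2) := p12 _ _ _
  have hl : CodeFP (pairE (pairE natE natE) (rawE natE)) (rawE natE) (fun q => q.2) := snd _ _
  have hdes := deserialize'_code.comp hl
  have hflag := hdes.fst'
  have hn := hdes.snd'.fst'
  have hout := hdes.snd'.snd'.fst'
  have hgs := hdes.snd'.snd'.snd'
  have hv := (validC_code dE).comp (hw.pair (hsz.pair (hout.pair hgs)))
  have h := (hflag.and (natEq.comp (hn.pair hw))).and hv
  exact h.congr fun q => by simp only [codeOK]

/-- `famsOK w dE sz NV nF fams` on codes: input `((w, sz, NV, nF), fams)`. [folklore] -/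
theorem famsOK_code (dE : ℕ) : CodeFP (pairE (pairE natE (pairE natE (pairE natE natE))) (rawE (rawE (rawE natE)))) bitE
    (fun q => famsOK q.1.1 dE q.1.2.1 q.1.2.2.1 q.1.2.2.2 q.2) := by
  -- context `(params, fams)`, then `((params, fams), f)`, then `(((params, fams), f), l)`
  have hpar : CodeFP (pairE (pairE natE (pairE natE (pairE natE natE))) (rawE (rawE (rawE natE))))
      (pairE natE (pairE natE (pairE natE natE))) (fun q => q.1) := fst _ _
  have hfams : CodeFP (pairE (pairE natE (pairE natE (pairE natE natE))) (rawE (rawE (rawE natE)))) (rawE (rawE (rawE natE)))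
      (fun q => q.2) := snd _ _
  have gq : CodeFP (pairE (pairE (pairE natE (pairE natE (pairE natE natE))) (rawE (rawE (rawE natE)))) (rawE (rawE natE)))
      (pairE (pairE natE (pairE natE (pairE natE natE))) (rawE (rawE (rawE natE)))) (fun q => q.1) := fst _ _
  have gf : CodeFP (pairE (pairE (pairE natE (pairE natE (pairE natE natE))) (rawE (rawE (rawE natE)))) (rawE (rawE natE)))
      (rawE (rawE natE)) (fun q => q.2) := snd _ _
  have lq : CodeFP (pairE (pairE (pairE (pairE natE (pairE natE (pairE natE natE))) (rawE (rawE (rawE natE)))) (rawE (rawE natE)))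
      (rawE natE)) (pairE (pairE natE (pairE natE (pairE natE natE))) (rawE (rawE (rawE natE)))) (fun q => q.1.1) := p11 _ _ _
  have ll : CodeFP (pairE (pairE (pairE (pairE natE (pairE natE (pairE natE natE))) (rawE (rawE (rawE natE)))) (rawE (rawE natE)))
      (rawE natE)) (rawE natE) (fun q => q.2) := snd _ _
  have hcode := (codeOK_code dE).comp ((((hpar.comp lq).fst').pair ((hpar.comp lq).snd'.fst')).pair ll)
  have hinner := all' hcode gf
  have hlenf := natEq.comp (((natLength _).comp gf).pair ((hpar.comp gq).snd'.snd'.fst'))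
  have hbody := hlenf.and hinner
  have houter := all' hbody hfams
  have hlen := natEq.comp (((natLength _).comp hfams).pair hpar.snd'.snd'.snd')
  have h := hlen.and houter
  exact h.congr fun q => by simp only [famsOK]

/-- `codeBlock m` on codes. [folklore] -/
theorem codeBlock_code (m : ℕ) : CodeFP (rawE natE) blockE (codeBlock m) := by
  have hdes := deserialize'_code
  have h := hdes.snd'.snd'.fst'.pair ((map₀ (canonC_code m)).comp hdes.snd'.snd'.snd')
  exact h.congr fun l => rfl

end Blocks

/-! ### VALUE on codes in the calculus -/

section Dnf

/-- The input code of `dnfCodeList`: `(1ⁿ, bcs, terms)`. [folklore] -/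
abbrev dnfInE : ℕ × List (WireC × List GateC) × List (List Lit) → List Bool :=
  pairE unE (pairE (rawE blockE) (rawE (rawE litE)))

/-- **`dnfCodeList n bcs terms` is computed on codes** (`n` in unary). [folklore] -/
theorem dnfCodeList_code : CodeFP dnfInE (rawE natE) (fun q => dnfCodeList q.1 q.2.1 q.2.2) := by
  have hnU : CodeFP dnfInE unE (fun q => q.1) := fst _ _
  have hn := natOfUn.comp hnU
  have hbcs : CodeFP dnfInE (rawE blockE) (fun q => q.2.1) := p21 _ _ _
  have hterms : CodeFP dnfInE (rawE (rawE litE)) (fun q => q.2.2) := p22 _ _ _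
  have hlayer := sGC'_code.comp hbcs
  have hgates := hlayer.fst'
  have houts := hlayer.snd'
  have hL1 := (natLength gateE).comp hgates
  have hNb := (natLength blockE).comp hbcs
  have hNbU := (ulength blockE).comp hbcs
  have hNt := (natLength (rawE litE)).comp hterms
  have hNtU := (ulength (rawE litE)).comp hterms
  have hfW := (cst dnfInE natE 1).pair hL1
  have htW := (cst dnfInE natE 1).pair (natAdd.comp (hL1.pair (cst dnfInE natE 1)))
  have hL2 := natAdd.comp ((natAdd.comp ((natAdd.comp (hL1.pair (cst dnfInE natE 2))).pair hNb)).pair hn)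
  have hbase := app' hgates (cst dnfInE (rawE gateE) [((2 : ℕ), ([] : List WireC)), (1, [])])
  -- wires of a number `k` in context `(q, k)`
  have wq : CodeFP (pairE dnfInE natE) dnfInE (fun t => t.1) := fst _ _
  have wk : CodeFP (pairE dnfInE natE) natE (fun t => t.2) := snd _ _
  have woutW := (natLt.comp (wk.pair (hNb.comp wq))).ite ((rawGetOr wireE).comp ((houts.comp wq).pair (wk.pair
    (cst _ wireE ((0 : ℕ), (0 : ℕ)))))) (hfW.comp wq)
  have winW := (natLt.comp (wk.pair (hn.comp wq))).ite ((cst _ natE 0).pair wk) (hfW.comp wq)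
  have wnotOutW := (natLt.comp (wk.pair (hNb.comp wq))).ite ((cst _ natE 1).pair (natAdd.comp ((natAdd.comp ((hL1.comp wq).pair
    (cst _ natE 2))).pair wk))) (htW.comp wq)
  have wnotInW := (natLt.comp (wk.pair (hn.comp wq))).ite ((cst _ natE 1).pair (natAdd.comp ((natAdd.comp ((natAdd.comp
    ((hL1.comp wq).pair (cst _ natE 2))).pair (hNb.comp wq))).pair wk))) (htW.comp wq)
  -- the negations
  have hnots1 := map' ((cst (pairE dnfInE natE) natE 0).pair (single' woutW)) (urange' hNbU)
  have hnots2 := map' ((cst (pairE dnfInE natE) natE 0).pair (single' winW)) (urange' hnU)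
  have hwithNots := app' hbase (app' hnots1 hnots2)
  -- the wire of a literal in context `(q, l)`; each wire function is re-based on the context `(q, l.2.2)`
  have lq : CodeFP (pairE dnfInE litE) dnfInE (fun t => t.1) := fst _ _
  have ll : CodeFP (pairE dnfInE litE) litE (fun t => t.2) := snd _ _
  have lk := lq.pair ll.snd'.snd'
  have hlitW := ll.snd'.fst'.ite (ll.fst'.ite (wnotInW.comp lk) (winW.comp lk)) (ll.fst'.ite (wnotOutW.comp lk) (woutW.comp lk))
  -- the term gates in context `(q, t)`, literals in context `((q, t), l)`
  have tq : CodeFP (pairE dnfInE (rawE litE)) dnfInE (fun t => t.1) := fst _ _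
  have tt : CodeFP (pairE dnfInE (rawE litE)) (rawE litE) (fun t => t.2) := snd _ _
  have uq : CodeFP (pairE (pairE dnfInE (rawE litE)) litE) dnfInE (fun t => t.1.1) := p11 _ _ _
  have ul : CodeFP (pairE (pairE dnfInE (rawE litE)) litE) litE (fun t => t.2) := snd _ _
  have hgateT := (cst (pairE dnfInE (rawE litE)) natE 1).pair (map' (hlitW.comp (uq.pair ul)) tt)
  have hwithTerms := app' hwithNots (map' hgateT hterms)
  -- the final gate and the output wire
  have rq : CodeFP (pairE dnfInE natE) dnfInE (fun t => t.1) := fst _ _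
  have rr : CodeFP (pairE dnfInE natE) natE (fun t => t.2) := snd _ _
  have hfinal := (orCode_code.comp hNt).pair (map' ((cst (pairE dnfInE natE) natE 1).pair (natAdd.comp ((hL2.comp rq).pair rr)))
    (urange' hNtU))
  have hgatesAll := app' hwithTerms (single' hfinal)
  have hout := (cst dnfInE natE 1).pair (natAdd.comp (hL2.pair hNt))
  have h := serialize_code.comp (hn.pair (hout.pair hgatesAll))
  refine h.congr fun q => ?_
  simp only [dnfCodeList, dnfGatesC, dnfOutC, finalGateC, withTermsC, L2C, withNotsC, inWC,
    outWC, fWC, baseC, L1C, layerC, ← sGC'_eq, id, decide_eq_true_eq]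
  unfold termGateC litWC notInWC notOutWC inWC outWC tWC fWC L1C layerC
  simp only [← sGC'_eq]

end Dnf

/-! ### The stage function is polynomial time -/

section Stage

variable (c m : ℕ) (M : TM2ComputableAux Bool Bool) (pT : Polynomial ℕ) (dE : ℕ) (qE : Polynomial ℕ)

/-- **The packed stage function of `A` is computed by an `FP` function on pairs.**
[cite: Williams2014, Lemma 3.1 (proof)] -/
theorem exists_stageAFn : ∃ F : List Bool → List Bool, F ∈ FP ∧ StageAFn c m M pT dE qE F := by
  -- input `(x, z)`
  have hx : CodeFP (pairE strE strE) strE (fun p => p.1) := fst _ _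
  have hz : CodeFP (pairE strE strE) strE (fun p => p.2) := snd _ _
  have hctx := (ctxOf_code c M pT).comp hx
  have hwU := hctx.snd'.fst'
  have hw := natOfUn.comp hwU
  have hNV := hctx.snd'.snd'.snd'.snd'.snd'.fst'
  have hrO := hctx.snd'.snd'.snd'.snd'.snd'.snd'
  have hsz := (natPoly_code qE).comp (natOfUn.comp (strLength.comp hx))
  have hnFU := unMul.comp ((cst _ unE 2).pair (unMul.comp ((cst _ unE 3).pair (unAdd.comp (hwU.pair (cst _ unE 2))))))
  have hnF := natOfUn.comp hnFU
  have hfams := parseGuess_code.comp hz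
  -- the flag, the block codes, the terms
  have hok := (famsOK_code dE).comp ((hw.pair (hsz.pair (hNV.pair hnF))).pair hfams)
  have hbcs := hok.ite ((map₀ (codeBlock_code m)).comp ((flatten (rawE natE)).comp hfams))
    (nil' (pairE strE strE) blockE)
  have hterms := hok.ite ((allTermsG_code M).comp hctx) (nil' (pairE strE strE) (rawE litE))
  -- VALUE and the printout
  have hdnf := dnfCodeList_code.comp (hwU.pair (hbcs.pair hterms))
  have pq : CodeFP (pairE (pairE strE strE) natE) (pairE strE strE) (fun t => t.1) := fst _ _
  have pp : CodeFP (pairE (pairE strE strE) natE) natE (fun t => t.2) := snd _ _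
  have hidx := natAdd.comp ((natMul.comp ((natMul.comp ((cst _ natE 2).pair pp)).pair (hNV.comp pq))).pair (hrO.comp pq))
  have hblk := (rawGetOr blockE).comp ((hbcs.comp pq).pair (hidx.pair (cst _ blockE (((0 : ℕ), (0 : ℕ)), ([] : List GateC)))))
  have hser := serialize_code.comp ((hw.comp pq).pair (hblk.fst'.pair hblk.snd'))
  have hprint := map' hser (urange' (unMul.comp ((cst _ unE 3).pair (unAdd.comp (hwU.pair (cst _ unE 2))))))
  -- packing
  have hpack : CodeFP (pairE strE strE) strE (fun p => packA (dnfCodeList (succinctWidth c p.1.length)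
      (if famsOK (succinctWidth c p.1.length) dE (qE.eval p.1.length) (NVn c M pT p.1.length) (nFam c p.1.length) (parseGuess p.2)
        then (parseGuess p.2).flatten.map (codeBlock m) else [])
      (if famsOK (succinctWidth c p.1.length) dE (qE.eval p.1.length) (NVn c M pT p.1.length) (nFam c p.1.length) (parseGuess p.2)
        then allTermsG M (ctxOf c M pT p.1) else []),
      famsOK (succinctWidth c p.1.length) dE (qE.eval p.1.length) (NVn c M pT p.1.length) (nFam c p.1.length) (parseGuess p.2),
      (List.range (3 * (succinctWidth c p.1.length + 2))).map fun pos => serialize (succinctWidth c p.1.length)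
        ((if famsOK (succinctWidth c p.1.length) dE (qE.eval p.1.length) (NVn c M pT p.1.length) (nFam c p.1.length) (parseGuess p.2)
          then (parseGuess p.2).flatten.map (codeBlock m) else []).getD (2 * pos * NVn c M pT p.1.length + rOut c M pT p.1.length)
          (((0 : ℕ), (0 : ℕ)), ([] : List GateC))).1
        ((if famsOK (succinctWidth c p.1.length) dE (qE.eval p.1.length) (NVn c M pT p.1.length) (nFam c p.1.length) (parseGuess p.2)
          then (parseGuess p.2).flatten.map (codeBlock m) else []).getD (2 * pos * NVn c M pT p.1.length + rOut c M pT p.1.length)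
          (((0 : ℕ), (0 : ℕ)), ([] : List GateC))).2)) :=
    ((listStr_code.comp hdnf).pair (hok.pair (listListStr_code.comp hprint))).recodeOut fun p => by
      simp only [pairE_apply, packA, id, bitE, nFam]
      rfl
  obtain ⟨F, hF, hFeq⟩ := hpack
  refine ⟨F, hF, fun x z => ?_⟩
  rw [show boolPair x z = pairE strE strE (x, z) from rfl, hFeq]
  simp only [stageA, okA, bcsA, termsA, printA, outIdx, allTermsG_ctxOf]
  rfl

end Stage

end MachineA

/-! ### The discharges -/

/-- **Williams 2014, Lemma 3.1** (the generator `A` of the clause circuits), discharged: the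
machine of `Williams2014MachineA.lean` with the polynomial-time stage function of this file.
[cite: Williams2014, Lemma 3.1] -/
theorem Williams2014_lemma_3_1_holds : Williams2014_lemma_3_1 :=
  Williams2014_lemma_3_1_of_stageA fun c m M pT dE qE => MachineA.exists_stageAFn c m M pT dE qE

/-- **Williams 2014, Theorem 3.2**, discharged: from Lemma 3.1 (`Williams2014_lemma_3_1_holds`) and
the machine `B` (`Williams2014_thm_3_2_machineB_holds`, `Williams2014SatInstanceFP.lean`).
[cite: Williams2014, Thm. 3.2] -/
theorem Williams2014_thm_3_2_holds : Williams2014_thm_3_2 :=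
  Williams2014_thm_3_2_of_lemma_3_1 Williams2014_lemma_3_1_holds

/-- **The `ACC` transfer theorem from its two remaining leaves**: `Williams2014_lowerBound_of_accSat`
follows from Fact 3.1 (succinct Cook–Levin) and Thm. 5.2 (succinct witnesses under `NEXP ⊆ ACC`);
Lemma 3.1, the machine `B` and the nondeterministic time hierarchy theorem are theorems of the tree.
[cite: Williams2014, Thm. 1.3 (proof)] -/
theorem Williams2014_lowerBound_of_accSat_of_two (h31 : Williams2014_fact_3_1) (h52 : Williams2014_thm_5_2) :
    Williams2014_lowerBound_of_accSat :=
  Williams2014_lowerBound_of_accSat_of_three h31 h52 Williams2014_lemma_3_1_holds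

end Literature.Computability.Complexity
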